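import Summits.BirchSwinnertonDyer.BirchSwinnertonDyer.Theorems.SemiOrdinaryEisensteinDescentWildSigmaDivisibilityAtThreeMultiCarrierTight
import Summits.BirchSwinnertonDyer.Rank1Residual.X11b.ChaPairsMinimality
import Literature.NumberTheory.EllipticCurves.Rank1Residual.X11RankOneCertificates.Minimality
import Summits.BirchSwinnertonDyer.Rank1Residual.X5.TwoAdicInstancesToolkitD
import HarnessLib

/-!
# Crux J‴ `WildSigmaDivisibilityAtThreeMultiCarrier` (stmt-BirchSwinnertonDyer-25898): THREE MORE COMPLETE INSTANCES on the census habitat —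
# the frames (166563a1, ℚ(√−11)), (202095a1, ℚ(√−11)), (209115a1, ℚ(√−11)), each by one exact 3-descent on the twist (kit j316201)
# (route `SemiOrdinaryEisensteinDescent`; width seat `bsd-wall-soed-p2-w2` g15; `--supports stmt-BirchSwinnertonDyer-25898`, helper; companion of `…InstanceF0`)

These are the three block-A habitat classes of J‴ (census `BLOCK-A-index.json`: image X4-onto, type W, reason JET-PRODUCT, `t = i3 = 2`, D of record `−11`) with the smallest odd twist
conductor `N·D²`: `166563a1 = [0,0,1,231,1228]` (`N = 3·…`, carriers `c₃ = 3`, `c₃₁ = 3`; `c₁₉₉ = 1`), `202095a1 = [0,0,1,11133,−34018]` (`c₃ = 3`, `c₅ = 12`; `c₄₉₉ = 1`),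
`209115a1 = [1,−1,1,−812,9586]` (`c₃ = 3`, `c₅ = 3`; `c₁₅₄₉ = 1`) — two Tamagawa 3-carriers of depth `1 < t = 2` each, Heegner at `−11` (PARI `precheck.json` of kit j316201). The
E-side certificate lines are tree records (`X4.ListC.bsdp3_d166563a1 / d202095a1 / d209115a1`: EXACT 3-descents `dim Sel^(3) = 1 = rank`, two engines); the E^D-side lines are rows
3–5 of kit j316201 (this seat; x11b `desc3lib.gp` sha256 c4fb20b7… byte-identical, EXACT mode `bnfcertify(A,1) = 1` + 3-saturation): on the reduced minimal models
`[0,0,1,27951,−1634801]` (`N = 20154123`), `[0,0,1,1347093,45277625]` (`N = 24453495`), `[1,−1,0,−98214,−12464677]` (`N = 25302915`) of the twists: `S`-class group trivial,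
`17 / 19 / 15` generators of `A(S,3)`, `dim H¹(ℚ,E^D[3];S) = 3 / 4 / 2`, **`dim Sel^(3)(E^D/ℚ) = 0`** (EXACT; 73 s / 54 s / 522 s). Per frame this file proves the explicit isomorphism
`C • E^{(−11)} = Wd` for the tree's `quadraticTwist`, `Wd` elliptic and globally minimal (Silverman's integer criterion at the primes `{3, 11}` of `gcd(Δ, c₄)`), and then J‴'s conclusion
on every frame over (E, ℚ(√−11)) by the `d_K = −11` form of the generic consumer (`…InstanceF0.sigma_at_of_certificateLines`; re-proved here in §0
directly from `Typed.bsdp_of_card_selmerGroup_eq_pow_analyticRank` ×2 + Tight §1 `sigma_at_of_bsdp_of_bsdp_towerFree`, so that this file's import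
cone is the Tight file's): two certificate lines + two `#Ш_an` unit lines + {Gross–Zagier, Kolyvagin, GZK, modularity, GZ86 I.(7.3), MN19 Thm.
0.7-lower}; NO h56, NO tower. THEOREMS ONLY; standard axioms; CONDITIONAL on the displayed lines and named
facts; four frames are not the crux; BSD is not proved by any of this; J‴ / `stub_flatMultiCarrier` stay open research.

References: [Miller2011LMS] Def. 1.1; [SilvermanAEC2009] VII.1 Remark 1.1, X.5 Cor. 5.4; [GrossZagier1986] I (6.3), (7.3); [MatarNekovar2019] Thm. 0.7; [Cremona2006]; [SchaeferStoll2004].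
-/

set_option autoImplicit false
set_option linter.dupNamespace false -- `Summit.BirchSwinnertonDyer.BirchSwinnertonDyer.…` is the tree's layout (D-0017)

noncomputable section

open scoped Classical

namespace Summit.BirchSwinnertonDyer.BirchSwinnertonDyer.Theorems.WildSigmaDivisibilityAtThreeMultiCarrierInstancesD11

open WeierstrassCurve NumberField Literature.NumberTheory.EllipticCurves
  Literature.NumberTheory.EllipticCurves.ModularForms
  Literature.NumberTheory.EllipticCurves.Rank1Residual
  Literature.NumberTheory.EllipticCurves.Rank1Residual.Typed
  Literature.NumberTheory.EllipticCurves.Rank1Residual.X11RankOneCertificates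
  Summit.BirchSwinnertonDyer.Rank1Residual
  Summit.BirchSwinnertonDyer.Rank1Residual.Additive
  Summit.BirchSwinnertonDyer.Rank1Residual.X11b
  Summit.BirchSwinnertonDyer.Rank1Residual.X11b.Three
  Summit.BirchSwinnertonDyer.BirchSwinnertonDyer.Theorems.WildSigmaDivisibilityAtThreeMultiCarrierTight

/-! ## §0 The shared frame shape: J‴'s conclusion over (E, ℚ(√−11)) from the two lines, given the twist model facts -/

/-- **Frame consumer at `d_K = −11`**: for an onto wild `r = 1` curve `W` and an explicit elliptic, globally minimal `Wd` with `C • W^{(−11)} = Wd`, the two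
certificate lines (`#Sel^(3)(W) = 3^{r_an}`, `#Sel^(3)(Wd) = 1`) + two `#Ш_an` unit lines + the six named facts give J‴'s conclusion on every frame over `(W, K)`,
`d_K = −11`: the class-free consumer `Typed.bsdp_of_card_selmerGroup_eq_pow_analyticRank` twice (the twist's `r_an = 0` from `L(W^{(−11)},1) ≠ 0` along `C`,
`entireLFunction_smul`) and Tight §1 `sigma_at_of_bsdp_of_bsdp_towerFree`; `Odd (−11)`, `−11 ≠ −3` discharged. (= the `d_K = −11` case of
`…InstanceF0.sigma_at_of_certificateLines`, p662266.) CONDITIONAL; nothing asserted about any curve. [cite: Miller2011LMS, §1 and Def. 1.1]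
[cite: GrossZagier1986, Thm. I.(6.3), (7.3) and V (2.2)] [cite: MatarNekovar2019, Thm. 0.7 (p. 456) and §0.11 (p. 457)] -/
theorem sigma_at_of_certificateLines_D11
    (hGZ : ∀ (N : ℕ) [NeZero N] (W : WeierstrassCurve ℚ) (K : Type) [Field K] [NumberField K],
      gross_zagier N W K)
    (hKo : ∀ (N : ℕ) [NeZero N] (W : WeierstrassCurve ℚ) (K : Type) [Field K] [NumberField K],
      kolyvagin N W K)
    (hGZK : rank_eq_analyticRank_of_analyticRank_le_one) (hmod : hasEntireLFunction_rat)
    (hGZ73 : GrossZagier1986_thm_I_7_3)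
    (hMNlow : MatarNekovar2019.thm07_pow_dvd_card_sha_primary_of_certificate_of_irreducible)
    (W : WeierstrassCurve ℚ) [W.IsElliptic] [W.IsGloballyMinimal] (N : ℕ) [NeZero N] (K : Type) [Field K]
    [NumberField K] (Dt : ModularParametrizationData W N) (H : HeegnerDatum N (NumberField.discr K))
    (ι : K →+* ℂ) (P : (W.baseChange K).toAffine.Point)
    (Wd : WeierstrassCurve ℚ) [Wd.IsElliptic] [Wd.IsGloballyMinimal] (hD : NumberField.discr K = -11)
    (hO6 : ClassO6 W 3) (hsurj : W.HasSurjectiveModNGaloisRep 3) (hr : W.analyticRank = 1) (hN : W.conductorNorm ℤ = N)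
    (hK : IsImaginaryQuadratic K) (hHH : SatisfiesHeegnerHypothesis N K)
    (hLd : (W.quadraticTwist (NumberField.discr K : ℚ)).entireLFunction 1 ≠ 0)
    (hP : WeierstrassCurve.Affine.Point.map ι.toRatAlgHom P = heegnerPointComplex Dt H) (hnt : ¬ IsOfFinAddOrder P)
    (hC : ∃ C : VariableChange ℚ, C • W.quadraticTwist (-11 : ℚ) = Wd)
    {q : ℚ} (hq : shaAn W = (q : ℂ)) (hv : padicValRat 3 q = 0)
    (hSel : Nat.card (W.selmerGroup (3 : ℤ)) = 3 ^ W.analyticRank)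
    {qd : ℚ} (hqd : shaAn Wd = (qd : ℂ)) (hvd : padicValRat 3 qd = 0)
    (hSeld : Nat.card (Wd.selmerGroup (3 : ℤ)) = 1) :
    ∀ (s' : ℕ), s' ≤ padicValNat 3 W.tamagawaProduct + padicValNat 3 Dt.c.natAbs →
      ∀ (n : ℕ) (d : KolyvaginHeegnerData Dt H.β ι n), Squarefree n →
        (∀ ℓ ∈ n.primeFactors, Zhang2014.IsKolyvaginPrime N W K 3 ℓ ∧
          s' ≤ Zhang2014.kolyvaginIndex W 3 ℓ) → Koly.PDiv d 3 s' := by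
  subst hN
  haveI : Fact (Nat.Prime 3) := ⟨Nat.prime_three⟩
  have hodd : Odd (NumberField.discr K) := by rw [hD]; decide
  have h3 : NumberField.discr K ≠ -3 := by rw [hD]; decide
  have hbsd : BSDp W 3 := bsdp_of_card_selmerGroup_eq_pow_analyticRank W 3 hGZK hr.le hq hv hSel
  have hD0 : ((NumberField.discr K : ℤ) : ℚ) ≠ 0 := by exact_mod_cast NumberField.discr_ne_zero K
  haveI : (W.quadraticTwist (NumberField.discr K : ℚ)).IsElliptic := W.isElliptic_quadraticTwist hD0
  obtain ⟨C, hCW⟩ := hC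
  have hCW' : C • W.quadraticTwist (NumberField.discr K : ℚ) = Wd := by rw [hD]; push_cast; exact hCW
  have hLd1 : Wd.entireLFunction 1 ≠ 0 := by rw [← hCW', entireLFunction_smul]; exact hLd
  have hrd : Wd.analyticRank = 0 := analyticRank_eq_zero_of_entireLFunction_one_ne_zero hLd1
  have hbsdd : BSDp Wd 3 := bsdp_of_card_selmerGroup_eq_pow_analyticRank Wd 3 hGZK (by rw [hrd]; exact zero_le_one) hqd hvd
    (by rw [hrd, pow_zero]; exact hSeld)
  exact sigma_at_of_bsdp_of_bsdp_towerFree hGZ hKo hGZK hmod hGZ73 hMNlow W K Dt H ι P Wd hO6 hsurj hr hK hHH hLd hP hnt hodd h3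
    ⟨C, hCW'⟩ hbsd hbsdd

/-! ## §1 Frame (166563a1, ℚ(√−11)): twist model `[0,0,1,27951,−1634801]` (`N = 20154123 = 166563·11²`) -/

/-- `⟨1, 0, 0, 1/2⟩ • (166563a1)^{(−11)} = [0,0,1,27951,−1634801]` on the nose (tree `quadraticTwist` = `[0,0,0,27951,−6539203/4]`). [cite: SilvermanAEC2009, X.5 Cor. 5.4 and III.1 Table 3.1] -/
theorem smul_quadraticTwist_166563a1_eq :
    (⟨1, 0, 0, 2⁻¹⟩ : VariableChange ℚ) • (⟨0, 0, 1, 231, 1228⟩ : WeierstrassCurve ℚ).quadraticTwist (-11 : ℚ) =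
      (⟨0, 0, 1, 27951, -1634801⟩ : WeierstrassCurve ℚ) := by
  ext <;> simp [quadraticTwist, variableChange_a₁, variableChange_a₂, variableChange_a₃, variableChange_a₄,
    variableChange_a₆, WeierstrassCurve.b₂, WeierstrassCurve.b₄, WeierstrassCurve.b₆] <;> norm_num

/-- `[0,0,1,27951,−1634801]` is an elliptic curve (`Δ = −2552116776877107 = −3⁵·11⁶·31³·199`). [cite: SilvermanAEC2009, III.1] -/
theorem isElliptic_tw_166563a1 : (⟨0, 0, 1, 27951, -1634801⟩ : WeierstrassCurve ℚ).IsElliptic :=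
  isElliptic_of_discOf_ne_zero 0 0 1 27951 (-1634801) (by decide +kernel)

/-- `[0,0,1,27951,−1634801]` is globally minimal: Silverman at the primes of `gcd(Δ, c₄) = 11979 = 3²·11³` (`ord₃ Δ = 5`, `ord₁₁ Δ = 6 < 12`). [cite: SilvermanAEC2009, VII.1 Remark 1.1] -/
theorem isGloballyMinimal_tw_166563a1 : (⟨0, 0, 1, 27951, -1634801⟩ : WeierstrassCurve ℚ).IsGloballyMinimal := by
  refine isGloballyMinimal_of_int_criterion 0 0 1 27951 (-1634801)
    (X5.Instances.int_criterion_of_primeFactors_gcd (by decide) ?_)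
  have hg : (Int.gcd (discOf [0, 0, 1, 27951, -1634801]) (c4Of [0, 0, 1, 27951, -1634801])).primeFactors = {3, 11} := by
    rw [show Int.gcd (discOf [0, 0, 1, 27951, -1634801]) (c4Of [0, 0, 1, 27951, -1634801]) = 3 ^ 2 * 11 ^ 3 by decide,
      Nat.primeFactors_mul (by norm_num) (by norm_num), Nat.primeFactors_prime_pow (by norm_num) Nat.prime_three,
      Nat.primeFactors_prime_pow (by norm_num) (by norm_num)]
    rfl
  rw [hg]; decide

/-- **J‴ ON EVERY FRAME OVER (166563a1, ℚ(√−11))** from the two certificate lines — `#Sel^(3)(166563a1) = 3^{r_an}` (tree record `X4.ListC.bsdp3_d166563a1`, kits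
j166148 / j179036) and `#Sel^(3)([0,0,1,27951,−1634801]) = 1` (kit j316201 row 3: EXACT, `dim Sel^(3) = 0`) — plus two `#Ш_an` unit lines and the six named facts. A block-A
habitat frame of J‴ (`c₃ = c₃₁ = 3`, `t = 2 = i3`). CONDITIONAL; one frame; BSD is not proved by this. [cite: Miller2011LMS, §1 and Def. 1.1] [cite: Cremona2006, Table 1 (label 166563a1)] -/
theorem sigma_at_166563a1_sqrtMinus11
    (hGZ : ∀ (N : ℕ) [NeZero N] (W : WeierstrassCurve ℚ) (K : Type) [Field K] [NumberField K],
      gross_zagier N W K)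
    (hKo : ∀ (N : ℕ) [NeZero N] (W : WeierstrassCurve ℚ) (K : Type) [Field K] [NumberField K],
      kolyvagin N W K)
    (hGZK : rank_eq_analyticRank_of_analyticRank_le_one) (hmod : hasEntireLFunction_rat)
    (hGZ73 : GrossZagier1986_thm_I_7_3)
    (hMNlow : MatarNekovar2019.thm07_pow_dvd_card_sha_primary_of_certificate_of_irreducible)
    (W : WeierstrassCurve ℚ) [W.IsElliptic] [W.IsGloballyMinimal] (N : ℕ) [NeZero N] (K : Type) [Field K]
    [NumberField K] (Dt : ModularParametrizationData W N) (H : HeegnerDatum N (NumberField.discr K))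
    (ι : K →+* ℂ) (P : (W.baseChange K).toAffine.Point)
    (hW : W = ⟨0, 0, 1, 231, 1228⟩) (hD : NumberField.discr K = -11)
    (hO6 : ClassO6 W 3) (hsurj : W.HasSurjectiveModNGaloisRep 3) (hr : W.analyticRank = 1) (hN : W.conductorNorm ℤ = N)
    (hK : IsImaginaryQuadratic K) (hHH : SatisfiesHeegnerHypothesis N K)
    (hLd : (W.quadraticTwist (NumberField.discr K : ℚ)).entireLFunction 1 ≠ 0)
    (hP : WeierstrassCurve.Affine.Point.map ι.toRatAlgHom P = heegnerPointComplex Dt H) (hnt : ¬ IsOfFinAddOrder P)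
    {q : ℚ} (hq : shaAn W = (q : ℂ)) (hv : padicValRat 3 q = 0)
    (hSel : Nat.card (W.selmerGroup (3 : ℤ)) = 3 ^ W.analyticRank)
    {qd : ℚ} (hqd : shaAn (⟨0, 0, 1, 27951, -1634801⟩ : WeierstrassCurve ℚ) = (qd : ℂ)) (hvd : padicValRat 3 qd = 0)
    (hSeld : Nat.card ((⟨0, 0, 1, 27951, -1634801⟩ : WeierstrassCurve ℚ).selmerGroup (3 : ℤ)) = 1) :
    ∀ (s' : ℕ), s' ≤ padicValNat 3 W.tamagawaProduct + padicValNat 3 Dt.c.natAbs →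
      ∀ (n : ℕ) (d : KolyvaginHeegnerData Dt H.β ι n), Squarefree n →
        (∀ ℓ ∈ n.primeFactors, Zhang2014.IsKolyvaginPrime N W K 3 ℓ ∧
          s' ≤ Zhang2014.kolyvaginIndex W 3 ℓ) → Koly.PDiv d 3 s' := by
  haveI := isElliptic_tw_166563a1
  haveI := isGloballyMinimal_tw_166563a1
  have hC : ∃ C : VariableChange ℚ, C • W.quadraticTwist (-11 : ℚ) = (⟨0, 0, 1, 27951, -1634801⟩ : WeierstrassCurve ℚ) :=
    ⟨⟨1, 0, 0, 2⁻¹⟩, by rw [hW]; exact smul_quadraticTwist_166563a1_eq⟩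
  exact sigma_at_of_certificateLines_D11 hGZ hKo hGZK hmod hGZ73 hMNlow W N K Dt H ι P _ hD hO6 hsurj hr hN hK hHH hLd hP hnt hC
    hq hv hSel hqd hvd hSeld

/-! ## §2 Frame (202095a1, ℚ(√−11)): twist model `[0,0,1,1347093,45277625]` (`N = 24453495 = 202095·11²`) -/

/-- `⟨1, 0, 0, 1/2⟩ • (202095a1)^{(−11)} = [0,0,1,1347093,45277625]` on the nose (tree `quadraticTwist` = `[0,0,0,1347093,181110501/4]`). [cite: SilvermanAEC2009, X.5 Cor. 5.4 and III.1 Table 3.1] -/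
theorem smul_quadraticTwist_202095a1_eq :
    (⟨1, 0, 0, 2⁻¹⟩ : VariableChange ℚ) • (⟨0, 0, 1, 11133, -34018⟩ : WeierstrassCurve ℚ).quadraticTwist (-11 : ℚ) =
      (⟨0, 0, 1, 1347093, 45277625⟩ : WeierstrassCurve ℚ) := by
  ext <;> simp [quadraticTwist, variableChange_a₁, variableChange_a₂, variableChange_a₃, variableChange_a₄,
    variableChange_a₆, WeierstrassCurve.b₂, WeierstrassCurve.b₄, WeierstrassCurve.b₆] <;> norm_num

/-- `[0,0,1,1347093,45277625]` is an elliptic curve (`Δ = −157334598762451171875 = −3⁶·5¹²·11⁶·499`). [cite: SilvermanAEC2009, III.1] -/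
theorem isElliptic_tw_202095a1 : (⟨0, 0, 1, 1347093, 45277625⟩ : WeierstrassCurve ℚ).IsElliptic :=
  isElliptic_of_discOf_ne_zero 0 0 1 1347093 45277625 (by decide +kernel)

/-- `[0,0,1,1347093,45277625]` is globally minimal: Silverman at the primes of `gcd(Δ, c₄) = 3267 = 3³·11²` (`ord₃ Δ = 6`, `ord₁₁ Δ = 6 < 12`; at `5`, `ord₅ Δ = 12` but `5 ∤ c₄`). [cite: SilvermanAEC2009, VII.1 Remark 1.1] -/
theorem isGloballyMinimal_tw_202095a1 : (⟨0, 0, 1, 1347093, 45277625⟩ : WeierstrassCurve ℚ).IsGloballyMinimal := by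
  refine isGloballyMinimal_of_int_criterion 0 0 1 1347093 45277625
    (X5.Instances.int_criterion_of_primeFactors_gcd (by decide) ?_)
  have hg : (Int.gcd (discOf [0, 0, 1, 1347093, 45277625]) (c4Of [0, 0, 1, 1347093, 45277625])).primeFactors = {3, 11} := by
    rw [show Int.gcd (discOf [0, 0, 1, 1347093, 45277625]) (c4Of [0, 0, 1, 1347093, 45277625]) = 3 ^ 3 * 11 ^ 2 by decide,
      Nat.primeFactors_mul (by norm_num) (by norm_num), Nat.primeFactors_prime_pow (by norm_num) Nat.prime_three,
      Nat.primeFactors_prime_pow (by norm_num) (by norm_num)]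
    rfl
  rw [hg]; decide

/-- **J‴ ON EVERY FRAME OVER (202095a1, ℚ(√−11))** from the two certificate lines — `#Sel^(3)(202095a1) = 3^{r_an}` (tree record `X4.ListC.bsdp3_d202095a1`, kits
j165392 / j179239) and `#Sel^(3)([0,0,1,1347093,45277625]) = 1` (kit j316201 row 4: EXACT, `dim Sel^(3) = 0`) — plus two `#Ш_an` unit lines and the six named facts. A block-A
habitat frame of J‴ (`c₃ = 3`, `c₅ = 12`, `t = 2 = i3`). CONDITIONAL; one frame; BSD is not proved by this. [cite: Miller2011LMS, §1 and Def. 1.1] [cite: Cremona2006, Table 1 (label 202095a1)] -/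
theorem sigma_at_202095a1_sqrtMinus11
    (hGZ : ∀ (N : ℕ) [NeZero N] (W : WeierstrassCurve ℚ) (K : Type) [Field K] [NumberField K],
      gross_zagier N W K)
    (hKo : ∀ (N : ℕ) [NeZero N] (W : WeierstrassCurve ℚ) (K : Type) [Field K] [NumberField K],
      kolyvagin N W K)
    (hGZK : rank_eq_analyticRank_of_analyticRank_le_one) (hmod : hasEntireLFunction_rat)
    (hGZ73 : GrossZagier1986_thm_I_7_3)
    (hMNlow : MatarNekovar2019.thm07_pow_dvd_card_sha_primary_of_certificate_of_irreducible)
    (W : WeierstrassCurve ℚ) [W.IsElliptic] [W.IsGloballyMinimal] (N : ℕ) [NeZero N] (K : Type) [Field K]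
    [NumberField K] (Dt : ModularParametrizationData W N) (H : HeegnerDatum N (NumberField.discr K))
    (ι : K →+* ℂ) (P : (W.baseChange K).toAffine.Point)
    (hW : W = ⟨0, 0, 1, 11133, -34018⟩) (hD : NumberField.discr K = -11)
    (hO6 : ClassO6 W 3) (hsurj : W.HasSurjectiveModNGaloisRep 3) (hr : W.analyticRank = 1) (hN : W.conductorNorm ℤ = N)
    (hK : IsImaginaryQuadratic K) (hHH : SatisfiesHeegnerHypothesis N K)
    (hLd : (W.quadraticTwist (NumberField.discr K : ℚ)).entireLFunction 1 ≠ 0)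
    (hP : WeierstrassCurve.Affine.Point.map ι.toRatAlgHom P = heegnerPointComplex Dt H) (hnt : ¬ IsOfFinAddOrder P)
    {q : ℚ} (hq : shaAn W = (q : ℂ)) (hv : padicValRat 3 q = 0)
    (hSel : Nat.card (W.selmerGroup (3 : ℤ)) = 3 ^ W.analyticRank)
    {qd : ℚ} (hqd : shaAn (⟨0, 0, 1, 1347093, 45277625⟩ : WeierstrassCurve ℚ) = (qd : ℂ)) (hvd : padicValRat 3 qd = 0)
    (hSeld : Nat.card ((⟨0, 0, 1, 1347093, 45277625⟩ : WeierstrassCurve ℚ).selmerGroup (3 : ℤ)) = 1) :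
    ∀ (s' : ℕ), s' ≤ padicValNat 3 W.tamagawaProduct + padicValNat 3 Dt.c.natAbs →
      ∀ (n : ℕ) (d : KolyvaginHeegnerData Dt H.β ι n), Squarefree n →
        (∀ ℓ ∈ n.primeFactors, Zhang2014.IsKolyvaginPrime N W K 3 ℓ ∧
          s' ≤ Zhang2014.kolyvaginIndex W 3 ℓ) → Koly.PDiv d 3 s' := by
  haveI := isElliptic_tw_202095a1
  haveI := isGloballyMinimal_tw_202095a1
  have hC : ∃ C : VariableChange ℚ, C • W.quadraticTwist (-11 : ℚ) = (⟨0, 0, 1, 1347093, 45277625⟩ : WeierstrassCurve ℚ) :=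
    ⟨⟨1, 0, 0, 2⁻¹⟩, by rw [hW]; exact smul_quadraticTwist_202095a1_eq⟩
  exact sigma_at_of_certificateLines_D11 hGZ hKo hGZK hmod hGZ73 hMNlow W N K Dt H ι P _ hD hO6 hsurj hr hN hK hHH hLd hP hnt hC
    hq hv hSel hqd hvd hSeld

/-! ## §3 Frame (209115a1, ℚ(√−11)): twist model `[1,−1,0,−98214,−12464677]` (`N = 25302915 = 209115·11²`) -/

/-- `⟨1, −3, 1/2, 0⟩ • (209115a1)^{(−11)} = [1,−1,0,−98214,−12464677]` on the nose (tree `quadraticTwist` = `[0,33/4,0,−196383/2,−51037195/4]`). [cite: SilvermanAEC2009, X.5 Cor. 5.4 and III.1 Table 3.1] -/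
theorem smul_quadraticTwist_209115a1_eq :
    (⟨1, -3, 2⁻¹, 0⟩ : VariableChange ℚ) • (⟨1, -1, 1, -812, 9586⟩ : WeierstrassCurve ℚ).quadraticTwist (-11 : ℚ) =
      (⟨1, -1, 0, -98214, -12464677⟩ : WeierstrassCurve ℚ) := by
  ext <;> simp [quadraticTwist, variableChange_a₁, variableChange_a₂, variableChange_a₃, variableChange_a₄,
    variableChange_a₆, WeierstrassCurve.b₂, WeierstrassCurve.b₄, WeierstrassCurve.b₆] <;> norm_num

/-- `[1,−1,0,−98214,−12464677]` is an elliptic curve (`Δ = −6751633108435875 = −3⁹·5³·11⁶·1549`). [cite: SilvermanAEC2009, III.1] -/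
theorem isElliptic_tw_209115a1 : (⟨1, -1, 0, -98214, -12464677⟩ : WeierstrassCurve ℚ).IsElliptic :=
  isElliptic_of_discOf_ne_zero 1 (-1) 0 (-98214) (-12464677) (by decide +kernel)

/-- `[1,−1,0,−98214,−12464677]` is globally minimal: Silverman at the primes of `gcd(Δ, c₄) = 9801 = 3⁴·11²` (`ord₃ Δ = 9`, `ord₁₁ Δ = 6 < 12`). [cite: SilvermanAEC2009, VII.1 Remark 1.1] -/
theorem isGloballyMinimal_tw_209115a1 : (⟨1, -1, 0, -98214, -12464677⟩ : WeierstrassCurve ℚ).IsGloballyMinimal := by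
  refine isGloballyMinimal_of_int_criterion 1 (-1) 0 (-98214) (-12464677)
    (X5.Instances.int_criterion_of_primeFactors_gcd (by decide) ?_)
  have hg : (Int.gcd (discOf [1, -1, 0, -98214, -12464677]) (c4Of [1, -1, 0, -98214, -12464677])).primeFactors = {3, 11} := by
    rw [show Int.gcd (discOf [1, -1, 0, -98214, -12464677]) (c4Of [1, -1, 0, -98214, -12464677]) = 3 ^ 4 * 11 ^ 2 by decide,
      Nat.primeFactors_mul (by norm_num) (by norm_num), Nat.primeFactors_prime_pow (by norm_num) Nat.prime_three,
      Nat.primeFactors_prime_pow (by norm_num) (by norm_num)]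
    rfl
  rw [hg]; decide

/-- **J‴ ON EVERY FRAME OVER (209115a1, ℚ(√−11))** from the two certificate lines — `#Sel^(3)(209115a1) = 3^{r_an}` (tree record `X4.ListC.bsdp3_d209115a1`, kits
j166163 / j171290) and `#Sel^(3)([1,−1,0,−98214,−12464677]) = 1` (kit j316201 row 5: EXACT, `dim Sel^(3) = 0`, 522 s) — plus two `#Ш_an` unit lines and the six named facts. A block-A
habitat frame of J‴ (`c₃ = c₅ = 3`, `t = 2 = i3`). CONDITIONAL; one frame; BSD is not proved by this. [cite: Miller2011LMS, §1 and Def. 1.1] [cite: Cremona2006, Table 1 (label 209115a1)] -/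
theorem sigma_at_209115a1_sqrtMinus11
    (hGZ : ∀ (N : ℕ) [NeZero N] (W : WeierstrassCurve ℚ) (K : Type) [Field K] [NumberField K],
      gross_zagier N W K)
    (hKo : ∀ (N : ℕ) [NeZero N] (W : WeierstrassCurve ℚ) (K : Type) [Field K] [NumberField K],
      kolyvagin N W K)
    (hGZK : rank_eq_analyticRank_of_analyticRank_le_one) (hmod : hasEntireLFunction_rat)
    (hGZ73 : GrossZagier1986_thm_I_7_3)
    (hMNlow : MatarNekovar2019.thm07_pow_dvd_card_sha_primary_of_certificate_of_irreducible)
    (W : WeierstrassCurve ℚ) [W.IsElliptic] [W.IsGloballyMinimal] (N : ℕ) [NeZero N] (K : Type) [Field K]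
    [NumberField K] (Dt : ModularParametrizationData W N) (H : HeegnerDatum N (NumberField.discr K))
    (ι : K →+* ℂ) (P : (W.baseChange K).toAffine.Point)
    (hW : W = ⟨1, -1, 1, -812, 9586⟩) (hD : NumberField.discr K = -11)
    (hO6 : ClassO6 W 3) (hsurj : W.HasSurjectiveModNGaloisRep 3) (hr : W.analyticRank = 1) (hN : W.conductorNorm ℤ = N)
    (hK : IsImaginaryQuadratic K) (hHH : SatisfiesHeegnerHypothesis N K)
    (hLd : (W.quadraticTwist (NumberField.discr K : ℚ)).entireLFunction 1 ≠ 0)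
    (hP : WeierstrassCurve.Affine.Point.map ι.toRatAlgHom P = heegnerPointComplex Dt H) (hnt : ¬ IsOfFinAddOrder P)
    {q : ℚ} (hq : shaAn W = (q : ℂ)) (hv : padicValRat 3 q = 0)
    (hSel : Nat.card (W.selmerGroup (3 : ℤ)) = 3 ^ W.analyticRank)
    {qd : ℚ} (hqd : shaAn (⟨1, -1, 0, -98214, -12464677⟩ : WeierstrassCurve ℚ) = (qd : ℂ)) (hvd : padicValRat 3 qd = 0)
    (hSeld : Nat.card ((⟨1, -1, 0, -98214, -12464677⟩ : WeierstrassCurve ℚ).selmerGroup (3 : ℤ)) = 1) :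
    ∀ (s' : ℕ), s' ≤ padicValNat 3 W.tamagawaProduct + padicValNat 3 Dt.c.natAbs →
      ∀ (n : ℕ) (d : KolyvaginHeegnerData Dt H.β ι n), Squarefree n →
        (∀ ℓ ∈ n.primeFactors, Zhang2014.IsKolyvaginPrime N W K 3 ℓ ∧
          s' ≤ Zhang2014.kolyvaginIndex W 3 ℓ) → Koly.PDiv d 3 s' := by
  haveI := isElliptic_tw_209115a1
  haveI := isGloballyMinimal_tw_209115a1
  have hC : ∃ C : VariableChange ℚ, C • W.quadraticTwist (-11 : ℚ) = (⟨1, -1, 0, -98214, -12464677⟩ : WeierstrassCurve ℚ) :=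
    ⟨⟨1, -3, 2⁻¹, 0⟩, by rw [hW]; exact smul_quadraticTwist_209115a1_eq⟩
  exact sigma_at_of_certificateLines_D11 hGZ hKo hGZK hmod hGZ73 hMNlow W N K Dt H ι P _ hD hO6 hsurj hr hN hK hHH hLd hP hnt hC
    hq hv hSel hqd hvd hSeld

end Summit.BirchSwinnertonDyer.BirchSwinnertonDyer.Theorems.WildSigmaDivisibilityAtThreeMultiCarrierInstancesD11

end
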